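import Mathlib.Analysis.InnerProductSpace.Dual
import Mathlib.Analysis.LocallyConvex.Separation
import Mathlib.Analysis.Normed.Affine.AddTorsorBases
import Mathlib.Analysis.Convex.Topology
import Literature.Geometry.DiscreteGeometry.SphericalCapVolume
import Literature.Geometry.DiscreteGeometry.SphericalCodeContactGraph
import HarnessLib

/-!
# Spherical codes in a hemisphere: the cap-packing bound, and balance of twelve-point `60°`-codes

Topic `Literature/Geometry/DiscreteGeometry`.  The classical area (here: solid-angle) argument
bounding the number of points of a spherical code lying in a closed hemisphere, from
`SphericalCapVolume.lean` (`volume_capCone`):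

* `card_mul_le_of_code_in_hemisphere` — if `N` unit vectors of `ℝ³` pairwise at inner product
  `≤ 2c² − 1` (angular separation `≥ 2·arccos c`) all lie in the closed hemisphere `⟪a, ·⟫ ≥ 0`,
  then `N (1 − c) ≤ 1 + √(1 − c²)`: the open cones of half-angle `arccos c` about the points are
  pairwise disjoint and miss the cone of half-angle `arcsin c` about `−a`, so their volumes add up
  inside the unit ball minus that cone (`N · (2π/3)(1 − c) ≤ 4π/3 − (2π/3)(1 − √(1 − c²))`).
* `exists_inner_neg_of_twelve` — twelve unit vectors pairwise at inner product `≤ 2c² − 1` with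
  `12 (1 − c) > 1 + √(1 − c²)` (e.g. `c = 867/1000`, covering separation `⟪·,·⟫ ≤ 0.503`, i.e.
  angles `≥ 59.8°`) meet every open hemisphere: `∀ v ≠ 0, ∃ x, ⟪v, x⟫ < 0`;
* `zero_mem_interior_convexHull_of_forall_exists_inner_neg` — a finite set meeting every open
  hemisphere has `0` in the interior of its convex hull (Hahn–Banach), the hypothesis `h0` of the
  tree's hull face theory (`SphericalCodeHullEulerFormula.euler_formula`).
-/

noncomputable section

namespace Literature.Geometry.DiscreteGeometry

open Real RealInnerProductSpace MeasureTheory Measure Metric Set Module Finset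

/-! ### Part 1. A spherical triangle inequality in inner products -/

/-- **Inner-product triangle inequality on the sphere**: for unit vectors `v, u, w`,
`⟪v, u⟫ ⟪v, w⟫ − √(1 − ⟪v, u⟫²) √(1 − ⟪v, w⟫²) ≤ ⟪u, w⟫` (`cos (α + β) ≤ cos γ` for the angles
`α = ∠(u,v)`, `β = ∠(v,w)`, `γ = ∠(u,w)`): split `u, w` into components along `v` and tangent
ones, and apply Cauchy–Schwarz to the tangent components. [folklore] -/
theorem inner_mul_inner_sub_sqrt_le {v u w : EuclideanSpace ℝ (Fin 3)} (hv : ‖v‖ = 1)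
    (hu : ‖u‖ = 1) (hw : ‖w‖ = 1) :
    ⟪v, u⟫ * ⟪v, w⟫ - Real.sqrt (1 - ⟪v, u⟫ ^ 2) * Real.sqrt (1 - ⟪v, w⟫ ^ 2) ≤ ⟪u, w⟫ := by
  have h1 := inner_tangentProj v u w hv
  have hcs := abs_real_inner_le_norm (tangentProj v u) (tangentProj v w)
  have hnu : ‖tangentProj v u‖ = Real.sqrt (1 - ⟪v, u⟫ ^ 2) := by
    rw [← norm_sq_tangentProj hv hu, Real.sqrt_sq (norm_nonneg _)]
  have hnw : ‖tangentProj v w‖ = Real.sqrt (1 - ⟪v, w⟫ ^ 2) := by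
    rw [← norm_sq_tangentProj hv hw, Real.sqrt_sq (norm_nonneg _)]
  rw [hnu, hnw, h1] at hcs
  have := neg_abs_le (⟪u, w⟫ - ⟪v, u⟫ * ⟪v, w⟫)
  linarith

/-! ### Part 2. Cones about the points of a code -/

/-- A point of the open cone `capCone x c` is nonzero. [folklore] -/
theorem ne_zero_of_mem_capCone {x y : EuclideanSpace ℝ (Fin 3)} {c : ℝ}
    (hy : y ∈ capCone x c) : y ≠ 0 := by
  intro h0
  have := hy.1
  rw [mem_setOf_eq, h0, norm_zero, mul_zero, inner_zero_right] at this
  exact lt_irrefl _ this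

/-- A point of `capCone x c` normalises to a unit vector at inner product `> c` with `x`.
[folklore] -/
theorem lt_inner_normalise_of_mem_capCone {x y : EuclideanSpace ℝ (Fin 3)} {c : ℝ}
    (hy : y ∈ capCone x c) : c < ⟪x, ‖y‖⁻¹ • y⟫ := by
  have hy0 := ne_zero_of_mem_capCone hy
  have hn : 0 < ‖y‖ := norm_pos_iff.2 hy0
  rw [real_inner_smul_right, lt_inv_mul_iff₀ hn]
  simpa [mul_comm] using hy.1

/-- **Cones about well-separated points are disjoint.** If `x, x'` are unit vectors with
`⟪x, x'⟫ ≤ 2c² − 1` (`c ≥ 0`), the open cones of half-angle `arccos c` about them do not meet: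
a common point `y` would give `⟪x, x'⟫ > c·c − √(1−c²)√(1−c²) = 2c² − 1`. [folklore] -/
theorem disjoint_capCone {x x' : EuclideanSpace ℝ (Fin 3)} (hx : ‖x‖ = 1) (hx' : ‖x'‖ = 1)
    {c : ℝ} (hc : 0 ≤ c) (hc1 : c ≤ 1) (hsep : ⟪x, x'⟫ ≤ 2 * c ^ 2 - 1) :
    Disjoint (capCone x c) (capCone x' c) := by
  rw [Set.disjoint_left]
  intro y hy hy'
  have hy0 := ne_zero_of_mem_capCone hy
  set u : EuclideanSpace ℝ (Fin 3) := ‖y‖⁻¹ • y with hu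
  have hun : ‖u‖ = 1 := by
    rw [hu, norm_smul, norm_inv, norm_norm, inv_mul_cancel₀ (norm_ne_zero_iff.2 hy0)]
  have h1 : c < ⟪x, u⟫ := lt_inner_normalise_of_mem_capCone hy
  have h2 : c < ⟪x', u⟫ := lt_inner_normalise_of_mem_capCone hy'
  have h2' : c < ⟪u, x'⟫ := by rwa [real_inner_comm]
  have htri := inner_mul_inner_sub_sqrt_le hun hx hx'
  rw [real_inner_comm x u] at htri
  -- bounds on the two factors
  have hxu1 : ⟪x, u⟫ ≤ 1 := by
    have := real_inner_le_norm x u; rw [hx, hun, one_mul] at this; exact this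
  have hux1 : ⟪u, x'⟫ ≤ 1 := by
    have := real_inner_le_norm u x'; rw [hun, hx', one_mul] at this; exact this
  have hA : Real.sqrt (1 - ⟪x, u⟫ ^ 2) < Real.sqrt (1 - c ^ 2) := by
    apply Real.sqrt_lt_sqrt
    · nlinarith
    · nlinarith
  have hB : Real.sqrt (1 - ⟪u, x'⟫ ^ 2) < Real.sqrt (1 - c ^ 2) := by
    apply Real.sqrt_lt_sqrt
    · nlinarith
    · nlinarith
  have hs0 : 0 ≤ Real.sqrt (1 - ⟪x, u⟫ ^ 2) := Real.sqrt_nonneg _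
  have hs0' : 0 ≤ Real.sqrt (1 - ⟪u, x'⟫ ^ 2) := Real.sqrt_nonneg _
  have hprod : Real.sqrt (1 - ⟪x, u⟫ ^ 2) * Real.sqrt (1 - ⟪u, x'⟫ ^ 2) <
      Real.sqrt (1 - c ^ 2) * Real.sqrt (1 - c ^ 2) :=
    mul_lt_mul'' hA hB hs0 hs0'
  have hss : Real.sqrt (1 - c ^ 2) * Real.sqrt (1 - c ^ 2) = 1 - c ^ 2 :=
    Real.mul_self_sqrt (by nlinarith)
  have hcc : c * c < ⟪x, u⟫ * ⟪u, x'⟫ := mul_lt_mul'' h1 h2' hc hc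
  nlinarith

/-- **Cones about points of the hemisphere `⟪a, ·⟫ ≥ 0` miss the cone of half-angle `arcsin c`
about `−a`.** If `‖x‖ = 1`, `⟪a, x⟫ ≥ 0` and `y ∈ capCone x c`, then `y ∉ capCone (−a) √(1−c²)`:
`⟪a, ŷ⟫ ≥ ⟪a, x⟫⟪x, ŷ⟫ − √(1−⟪a,x⟫²)√(1−⟪x,ŷ⟫²) ≥ 0 − √(1 − c²)`. [folklore] -/
theorem not_mem_capCone_neg {a x y : EuclideanSpace ℝ (Fin 3)} (ha : ‖a‖ = 1) (hx : ‖x‖ = 1)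
    (hax : 0 ≤ ⟪a, x⟫) {c : ℝ} (hc : 0 ≤ c) (hy : y ∈ capCone x c) :
    y ∉ capCone (-a) (Real.sqrt (1 - c ^ 2)) := by
  intro hy'
  have hy0 := ne_zero_of_mem_capCone hy
  set u : EuclideanSpace ℝ (Fin 3) := ‖y‖⁻¹ • y with hu
  have hun : ‖u‖ = 1 := by
    rw [hu, norm_smul, norm_inv, norm_norm, inv_mul_cancel₀ (norm_ne_zero_iff.2 hy0)]
  have h1 : c < ⟪x, u⟫ := lt_inner_normalise_of_mem_capCone hy
  have h2 : Real.sqrt (1 - c ^ 2) < ⟪-a, u⟫ :=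
    lt_inner_normalise_of_mem_capCone hy'
  rw [inner_neg_left] at h2
  have htri := inner_mul_inner_sub_sqrt_le hx ha hun
  rw [real_inner_comm a x] at htri
  have hxu1 : ⟪x, u⟫ ≤ 1 := by
    have := real_inner_le_norm x u; rw [hx, hun, one_mul] at this; exact this
  have hax1 : ⟪a, x⟫ ≤ 1 := by
    have := real_inner_le_norm a x; rw [ha, hx, one_mul] at this; exact this
  have hA : Real.sqrt (1 - ⟪x, u⟫ ^ 2) ≤ Real.sqrt (1 - c ^ 2) := by
    apply Real.sqrt_le_sqrt; nlinarith
  have hB : Real.sqrt (1 - ⟪a, x⟫ ^ 2) ≤ 1 := by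
    rw [Real.sqrt_le_one]; nlinarith
  have hs0 : 0 ≤ Real.sqrt (1 - ⟪x, u⟫ ^ 2) := Real.sqrt_nonneg _
  have hs0' : 0 ≤ Real.sqrt (1 - ⟪a, x⟫ ^ 2) := Real.sqrt_nonneg _
  have hprod : Real.sqrt (1 - ⟪a, x⟫ ^ 2) * Real.sqrt (1 - ⟪x, u⟫ ^ 2) ≤
      1 * Real.sqrt (1 - c ^ 2) := mul_le_mul hB hA hs0 zero_le_one
  have hpos : 0 ≤ ⟪a, x⟫ * ⟪x, u⟫ := mul_nonneg hax (hc.trans h1.le)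
  linarith

/-! ### Part 3. The packing bound in a hemisphere -/

/-- `capCone x c ⊆ ball 0 1`. [folklore] -/
theorem capCone_subset_ball (x : EuclideanSpace ℝ (Fin 3)) (c : ℝ) : capCone x c ⊆ ball 0 1 :=
  Set.inter_subset_right

/-- **The cap-packing bound in a hemisphere.** Let `X` be a finite set of unit vectors of `ℝ³`
with pairwise inner products `≤ 2c² − 1` (`0 < c ≤ 1`), all lying in the closed hemisphere
`⟪a, ·⟫ ≥ 0` of the unit vector `a`. Then `|X| · (1 − c) ≤ 1 + √(1 − c²)`. [folklore] -/
theorem card_mul_le_of_code_in_hemisphere {X : Finset (EuclideanSpace ℝ (Fin 3))}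
    (hX1 : ∀ x ∈ X, ‖x‖ = 1) {c : ℝ} (hc : 0 < c) (hc1 : c ≤ 1)
    (hsep : ∀ x ∈ X, ∀ x' ∈ X, x ≠ x' → ⟪x, x'⟫ ≤ 2 * c ^ 2 - 1)
    {a : EuclideanSpace ℝ (Fin 3)} (ha : ‖a‖ = 1) (hhem : ∀ x ∈ X, 0 ≤ ⟪a, x⟫) :
    (X.card : ℝ) * (1 - c) ≤ 1 + Real.sqrt (1 - c ^ 2) := by
  set s := Real.sqrt (1 - c ^ 2) with hs
  have hs0 : 0 ≤ s := Real.sqrt_nonneg _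
  have hs1 : s ≤ 1 := by rw [hs, Real.sqrt_le_one]; nlinarith
  have hna : ‖-a‖ = 1 := by rw [norm_neg, ha]
  -- the union of the cones sits inside `ball \ capCone (-a) s`
  set U : Set (EuclideanSpace ℝ (Fin 3)) := ⋃ x ∈ X, capCone x c with hU
  have hUsub : U ⊆ ball 0 1 \ capCone (-a) s := by
    intro y hy
    rw [hU, Set.mem_iUnion₂] at hy
    obtain ⟨x, hx, hyx⟩ := hy
    exact ⟨capCone_subset_ball x c hyx, not_mem_capCone_neg ha (hX1 x hx) (hhem x hx) hc.le hyx⟩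
  -- measure of the union = sum of the cone volumes
  have hdisj : Set.PairwiseDisjoint (↑X : Set (EuclideanSpace ℝ (Fin 3))) fun x => capCone x c := by
    intro x hx x' hx' hne
    exact disjoint_capCone (hX1 x hx) (hX1 x' hx') hc.le hc1 (hsep x hx x' hx' hne)
  have hUvol : volume U = ∑ x ∈ X, volume (capCone x c) :=
    measure_biUnion_finset hdisj fun x _ => measurableSet_capCone x c
  have hcone : ∀ x ∈ X, volume (capCone x c) = ENNReal.ofReal (2 * π / 3 * (1 - c)) :=
    fun x hx => volume_capCone (hX1 x hx) hc hc1
  rw [Finset.sum_congr rfl hcone, Finset.sum_const, nsmul_eq_mul] at hUvol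
  -- measure of the difference
  have hdiff : volume (ball (0 : EuclideanSpace ℝ (Fin 3)) 1 \ capCone (-a) s) =
      volume (ball (0 : EuclideanSpace ℝ (Fin 3)) 1) - volume (capCone (-a) s) :=
    measure_sdiff (capCone_subset_ball _ _) (measurableSet_capCone _ _).nullMeasurableSet
      (lt_of_le_of_lt (measure_mono (μ := volume) (capCone_subset_ball (-a) s))
        measure_ball_lt_top).ne
  have hle := measure_mono (μ := volume) hUsub
  rw [hUvol, hdiff, EuclideanSpace.volume_ball_fin_three] at hle
  -- `volume_capCone` needs `0 < s`; treat `s = 0` (`c = 1`) apart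
  rcases eq_or_lt_of_le hs0 with hszero | hspos
  · -- `c = 1`: the claim is `|X| · 0 ≤ 1 + 0`
    have hc_one : c = 1 := by
      have h2 : 1 - c ^ 2 = 0 := by
        have := Real.sqrt_eq_zero'.1 hszero.symm
        nlinarith
      nlinarith
    rw [hc_one, ← hszero]; simp
  rw [volume_capCone hna hspos hs1, ← ENNReal.ofReal_pow zero_le_one, one_pow,
    ENNReal.ofReal_one, one_mul] at hle
  -- pass to real numbers
  have hfin : ENNReal.ofReal (π * 4 / 3) - ENNReal.ofReal (2 * π / 3 * (1 - s)) ≠ ⊤ :=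
    ENNReal.sub_ne_top ENNReal.ofReal_ne_top
  have hle' := ENNReal.toReal_mono hfin hle
  rw [ENNReal.toReal_mul, ENNReal.toReal_natCast, ENNReal.toReal_ofReal (by nlinarith [pi_pos]),
    ENNReal.toReal_sub_of_le (ENNReal.ofReal_le_ofReal (by nlinarith [pi_pos]))
      ENNReal.ofReal_ne_top,
    ENNReal.toReal_ofReal (by positivity), ENNReal.toReal_ofReal (by nlinarith [pi_pos])] at hle'
  -- `|X| · (2π/3)(1 − c) ≤ 4π/3 − (2π/3)(1 − s)`
  have hπ : 0 < 2 * π / 3 := by positivity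
  nlinarith

/-! ### Part 4. Twelve points: balance -/

/-- **Twelve well-separated unit vectors meet every open hemisphere.** If `X` consists of twelve
unit vectors of `ℝ³` with pairwise inner products `≤ 2c² − 1`, where `0 < c ≤ 1` and
`1 + √(1 − c²) < 12 (1 − c)` (for instance `c = 867/1000`: separation `⟪·,·⟫ ≤ 0.503378`, angles
`≥ 59.8°`), then for every `v ≠ 0` some `x ∈ X` has `⟪v, x⟫ < 0`. [folklore] -/
theorem exists_inner_neg_of_twelve {X : Finset (EuclideanSpace ℝ (Fin 3))}
    (hX1 : ∀ x ∈ X, ‖x‖ = 1) (hX : X.card = 12) {c : ℝ} (hc : 0 < c) (hc1 : c ≤ 1)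
    (hnum : 1 + Real.sqrt (1 - c ^ 2) < 12 * (1 - c))
    (hsep : ∀ x ∈ X, ∀ x' ∈ X, x ≠ x' → ⟪x, x'⟫ ≤ 2 * c ^ 2 - 1)
    {v : EuclideanSpace ℝ (Fin 3)} (hv : v ≠ 0) : ∃ x ∈ X, ⟪v, x⟫ < 0 := by
  by_contra hall
  push Not at hall
  set a : EuclideanSpace ℝ (Fin 3) := ‖v‖⁻¹ • v with ha
  have hvn : 0 < ‖v‖ := norm_pos_iff.2 hv
  have han : ‖a‖ = 1 := by
    rw [ha, norm_smul, norm_inv, norm_norm, inv_mul_cancel₀ hvn.ne']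
  have hhem : ∀ x ∈ X, 0 ≤ ⟪a, x⟫ := fun x hx => by
    rw [ha, real_inner_smul_left]
    exact mul_nonneg (inv_nonneg.2 hvn.le) (hall x hx)
  have := card_mul_le_of_code_in_hemisphere hX1 hc hc1 hsep han hhem
  rw [hX] at this
  push_cast at this
  linarith

/-- **A finite set meeting every open hemisphere has the centre in the interior of its hull**
(Hahn–Banach: a functional supporting `interior (conv X)` at `0` would be `≤ 0` on `X`; and the
points span affinely, else a normal functional is constant on `X`). [folklore] -/
theorem zero_mem_interior_convexHull_of_forall_exists_inner_neg
    {X : Finset (EuclideanSpace ℝ (Fin 3))} (hne : X.Nonempty)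
    (h : ∀ v : EuclideanSpace ℝ (Fin 3), v ≠ 0 → ∃ x ∈ X, ⟪v, x⟫ < 0) :
    (0 : EuclideanSpace ℝ (Fin 3)) ∈
      interior (convexHull ℝ (X : Set (EuclideanSpace ℝ (Fin 3)))) := by
  have hpos : ∀ v : EuclideanSpace ℝ (Fin 3), v ≠ 0 → ∃ x ∈ X, 0 < ⟪v, x⟫ := by
    intro v hv
    obtain ⟨x, hx, hlt⟩ := h (-v) (neg_ne_zero.2 hv)
    exact ⟨x, hx, by rwa [inner_neg_left, neg_lt_zero] at hlt⟩
  obtain ⟨x₀, hx₀⟩ := hne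
  -- affine span is everything
  have haff : affineSpan ℝ (X : Set (EuclideanSpace ℝ (Fin 3))) = ⊤ := by
    have hne' : (affineSpan ℝ (X : Set (EuclideanSpace ℝ (Fin 3))) :
        Set (EuclideanSpace ℝ (Fin 3))).Nonempty := ⟨x₀, mem_affineSpan ℝ hx₀⟩
    rw [← AffineSubspace.direction_eq_top_iff_of_nonempty hne', ← Submodule.orthogonal_eq_bot_iff]
    by_contra hbot
    obtain ⟨v, hv, hv0⟩ := Submodule.exists_mem_ne_zero_of_ne_bot hbot
    have hconst : ∀ x ∈ X, ⟪v, x⟫ = ⟪v, x₀⟫ := by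
      intro x hx
      have hmem : x -ᵥ x₀ ∈ (affineSpan ℝ (X : Set (EuclideanSpace ℝ (Fin 3)))).direction :=
        AffineSubspace.vsub_mem_direction (mem_affineSpan ℝ hx) (mem_affineSpan ℝ hx₀)
      have h0 : ⟪v, x -ᵥ x₀⟫ = 0 := by
        rw [real_inner_comm]
        exact (Submodule.mem_orthogonal _ v).1 hv _ hmem
      rwa [vsub_eq_sub, inner_sub_right, sub_eq_zero] at h0
    rcases le_or_gt 0 ⟪v, x₀⟫ with hc | hc
    · obtain ⟨x, hx, hlt⟩ := h v hv0
      rw [hconst x hx] at hlt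
      exact absurd hc (not_le.2 hlt)
    · obtain ⟨x, hx, hlt⟩ := hpos v hv0
      rw [hconst x hx] at hlt
      exact absurd hc (not_lt.2 hlt.le)
  set C := convexHull ℝ (X : Set (EuclideanSpace ℝ (Fin 3))) with hC
  have hCconv : Convex ℝ C := convex_convexHull ℝ _
  have hint : (interior C).Nonempty :=
    interior_convexHull_nonempty_iff_affineSpan_eq_top.2 haff
  by_contra h0
  obtain ⟨f, hf⟩ := geometric_hahn_banach_open_point hCconv.interior isOpen_interior h0
  rw [map_zero] at hf
  have hle : ∀ x ∈ X, f x ≤ 0 := by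
    intro x hx
    have hxC : x ∈ closure (interior C) := by
      rw [hCconv.closure_interior_eq_closure_of_nonempty_interior hint]
      exact subset_closure (subset_convexHull ℝ _ hx)
    have hclosed : IsClosed {z : EuclideanSpace ℝ (Fin 3) | f z ≤ 0} :=
      isClosed_le f.continuous continuous_const
    exact (hclosed.closure_subset_iff.2 fun z hz => (hf z hz).le) hxC
  set w : EuclideanSpace ℝ (Fin 3) := (InnerProductSpace.toDual ℝ (EuclideanSpace ℝ (Fin 3))).symm f
    with hw
  have hfw : ∀ z, f z = ⟪w, z⟫ := fun z => by rw [hw, InnerProductSpace.toDual_symm_apply]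
  have hw0 : w ≠ 0 := by
    intro hzero
    obtain ⟨p, hp⟩ := hint
    have := hf p hp
    rw [hfw, hzero, inner_zero_left] at this
    exact lt_irrefl _ this
  obtain ⟨x, hx, hlt⟩ := hpos w hw0
  have := hle x hx
  rw [hfw] at this
  linarith

/-- **Balance of a twelve-point soft kissing shell.** Twelve unit vectors of `ℝ³` with pairwise
inner products `≤ κ ≤ 0.503378 = 2·(0.867)² − 1` (angular separation `≥ 59.77°`; the route's
`κ = 1/2 + 2η`, `η ≤ 10⁻³`, qualifies) have `0` in the interior of their convex hull — the
hypothesis of the hull face theory (`euler_formula`). [folklore] -/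
theorem zero_mem_interior_convexHull_of_twelve_soft {X : Finset (EuclideanSpace ℝ (Fin 3))}
    (hX1 : ∀ x ∈ X, ‖x‖ = 1) (hX : X.card = 12) {κ : ℝ} (hκ : κ ≤ 503378 / 1000000)
    (hsep : ∀ x ∈ X, ∀ x' ∈ X, x ≠ x' → ⟪x, x'⟫ ≤ κ) :
    (0 : EuclideanSpace ℝ (Fin 3)) ∈
      interior (convexHull ℝ (X : Set (EuclideanSpace ℝ (Fin 3)))) := by
  have hne : X.Nonempty := by rw [← Finset.card_pos, hX]; norm_num
  refine zero_mem_interior_convexHull_of_forall_exists_inner_neg hne fun v hv => ?_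
  have hsqrt : Real.sqrt (1 - (867 / 1000 : ℝ) ^ 2) < 596 / 1000 := by
    rw [Real.sqrt_lt' (by norm_num)]; norm_num
  refine exists_inner_neg_of_twelve hX1 hX (c := 867 / 1000) (by norm_num) (by norm_num)
    (by linarith) (fun x hx x' hx' hne' => ?_) hv
  have := hsep x hx x' hx' hne'
  have h2 : (2 : ℝ) * (867 / 1000) ^ 2 - 1 = 503378 / 1000000 := by norm_num
  linarith

end Literature.Geometry.DiscreteGeometry


end
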